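import Summits.ABC.ABC.Theses.IUTThetaPilot
import Summits.ABC.IUTFork.LDHGenuinePerImageSlotConstant
import Summits.ABC.IUTFork.LDHGenuinePerImageExplicit
import Summits.ABC.IUTFork.LDHGenuineStepVPoint
import Literature.IUT.LogVolume.Corollary22PartIIUpTo
import HarnessLib

/-!
# Crux `ThetaPartII` (stmt-ABC-19678, route `IUTThetaPilot`), RESHAPE-2 skeleton: the (U) and (P) lines have THE SAME
# open content on slot-constant data — in particular at every degree-one point — and `stub_hullRegime` is void there

Proof-only helper of the abc-iut cell (seat abc-iut-c312-8, layer-2 skeleton holder). TAKES NO SIDE on [IUTchIII]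
Cor. 3.12. The registered skeleton of record (sha16 `3f4b202b4c999d58`, 2026-08-26) carries two compositions over the
same datum vocabulary `Cor22.ThetaVolumeDatumAt P l`: the (U) line `ThetaPartII_of` (open stubs `stub_cor312 :
… → Cor22.Cor312AtDatum P l` and `stub_hullRegime`, the hull estimate with `B_III` OFF the slot-constant regime = VERDICT
RISK ¶7) and the (P) line `ThetaPartII_of_perImage` (open stub `stub_cor312PerImage : … → Cor22.Cor312PerImageAtDatum P l`).
abc-iut-S7 proved, input by input, that the two readings of `−|log(Θ)|` ([IUTchIII] Cor. 3.12 p. 174: the hull of the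
UNION of the possible images; proof Step (x) p. 181: the hull of ONE image) are the SAME number on slot-constant data
(`DHData.cor312Of_iff_perImage_of_slotConstant`, `…_of_finrank_eq_one`). This file restates that in the registry's
`(P, l)`-vocabulary, so the adjudication record can cite it BY NAME:

* `cor312AtDatum_iff_perImage_of_slotConstant` — if every genuine datum at `(P, l)` is slot-constant, then
  `Cor22.Cor312AtDatum P l ↔ Cor22.Cor312PerImageAtDatum P l`; `cor312AtDatum_iff_perImage_of_dmod_eq_one` /
  `…_of_degree_le_one` — so at `d_mod(P) = 1` (e.g. `deg P ≤ 1`, `Cor22.dmod_eq_one_of_degree_le_one`) the two registered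
  crux-content stubs are ONE claim at `P` (abc-iut-c312-d1 `PointStepV.slotConstant_of_dmod_eq_one`);
* `hullVolumeAtDatum_iff_perImage_of_dmod_eq_one` — likewise for the computable halves (ii′)/(ii′-P);
* `hullRegime_vacuous_of_dmod_eq_one` — the hypothesis `¬ slot-constant` of the registered stub `stub_hullRegime` is FALSE
  at every datum of a `d_mod = 1` point: RISK ¶7 is void on the degree-one rung (where abc-iut-S2's
  `vojtaIneq_two_degOne_of_cor312` lives);
* `stub_cor312_iff_stub_cor312PerImage_on_degree_le_one` — the two stub SIGNATURES restricted to `P.degree ≤ 1` are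
  equivalent (binders exactly the registered ones plus the degree cut).
Nothing here bears on `d_mod ≥ 2` with a support prime split into places of different `q`-order (the locus of RISK ¶7).
[cite: Mochizuki2012, IUTchIII Cor. 3.12 p. 174] [cite: Mochizuki2012, IUTchIII Cor. 3.12 proof Step (x) p. 181]
[cite: Mochizuki2012, IUTchIV Thm. 1.10 proof Step (v) p. 27–28] [claim: Mochizuki2012, status: disputed]
HONEST FRAMING: equivalences and a vacuity statement between OPEN obligations; nothing is asserted about Cor. 3.12.
-/

noncomputable section

set_option linter.dupNamespace false

namespace Summit.ABC.ABC.Theorems.ThetaPartII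

open Literature.NumberTheory.DiophantineGeometry.GenEll Literature.IUT.LogVolume Literature.IUT.HodgeTheaters
open Summit.ABC.IUTFork NumberField IsDedekindDomain Literature.NumberTheory.NumberFields

variable {P : NFPoint} {l : ℕ}

/-- **(U) ⟺ (P) for Cor. 3.12 at the Θ-data of `(P, l)` when every datum there is slot-constant** (abc-iut-S7's
`DHData.cor312Of_iff_perImage_of_slotConstant`, datum by datum; the converse direction holds unconditionally,
`Cor22.cor312AtDatum_of_perImage`). [cite: Mochizuki2012, IUTchIII Cor. 3.12 p. 174] [claim: Mochizuki2012, status: disputed] -/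
theorem cor312AtDatum_iff_perImage_of_slotConstant
    (hconst : ∀ T : Cor22.ThetaVolumeDatumAt P l,
      letI := T.instFieldF; letI := T.instNumberFieldF; letI := T.instAlgebraF; letI := T.instIsElliptic
      letI := T.instFieldK; letI := T.instNumberFieldK; letI := T.instAlgebraK
      ∀ p ∈ T.I.supportPrimes, ∀ v w : placesOver (fieldOfModuli T.E) p,
        (DHData.ofInput T.I).logQloc p v = (DHData.ofInput T.I).logQloc p w) :
    Cor22.Cor312AtDatum P l ↔ Cor22.Cor312PerImageAtDatum P l := by
  refine ⟨fun h T => ?_, Cor22.cor312AtDatum_of_perImage⟩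
  letI := T.instFieldF; letI := T.instNumberFieldF; letI := T.instAlgebraF; letI := T.instIsElliptic
  letI := T.instFieldK; letI := T.instNumberFieldK; letI := T.instAlgebraK
  exact (DHData.cor312Of_iff_perImage_of_slotConstant T.I (hconst T)).mp (h T)

/-- **At a `d_mod = 1` point the two registered crux-content obligations are ONE claim**:
`Cor22.Cor312AtDatum P l ↔ Cor22.Cor312PerImageAtDatum P l` (one place of `F_mod` over each prime: abc-iut-c312-d1's
`PointStepV.slotConstant_of_dmod_eq_one`). [cite: Mochizuki2012, IUTchIII Cor. 3.12 p. 174] [claim: Mochizuki2012, status: disputed] -/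
theorem cor312AtDatum_iff_perImage_of_dmod_eq_one (hd : Cor22.dmod P = 1) :
    Cor22.Cor312AtDatum P l ↔ Cor22.Cor312PerImageAtDatum P l :=
  cor312AtDatum_iff_perImage_of_slotConstant fun T => PointStepV.slotConstant_of_dmod_eq_one T hd

/-- The same at a point of degree `≤ 1` (`Cor22.dmod_eq_one_of_degree_le_one`). [cite: Mochizuki2012, IUTchIII Cor. 3.12 p. 174]
[claim: Mochizuki2012, status: disputed] -/
theorem cor312AtDatum_iff_perImage_of_degree_le_one (hdeg : P.degree ≤ 1) :
    Cor22.Cor312AtDatum P l ↔ Cor22.Cor312PerImageAtDatum P l :=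
  cor312AtDatum_iff_perImage_of_dmod_eq_one (Cor22.dmod_eq_one_of_degree_le_one hdeg)

/-- **The computable halves coincide too at a `d_mod = 1` point**: `Cor22.HullVolumeAtDatum P l δ ↔
Cor22.HullVolumePerImageAtDatum P l δ` for every `δ`. [cite: Mochizuki2012, IUTchIV Thm. 1.10 proof Step (v) p. 27–28] -/
theorem hullVolumeAtDatum_iff_perImage_of_dmod_eq_one (hd : Cor22.dmod P = 1) (δ : ℝ) :
    Cor22.HullVolumeAtDatum P l δ ↔ Cor22.HullVolumePerImageAtDatum P l δ := by
  refine ⟨Cor22.hullVolumePerImageAtDatum_of_hullVolumeAtDatum, fun h T => ?_⟩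
  letI := T.instFieldF; letI := T.instNumberFieldF; letI := T.instAlgebraF; letI := T.instIsElliptic
  letI := T.instFieldK; letI := T.instNumberFieldK; letI := T.instAlgebraK
  exact (DHData.hullEstimateOf_iff_perImage_of_slotConstant T.I (PointStepV.slotConstant_of_dmod_eq_one T hd) δ).mpr
    (h T)

/-- **RISK ¶7 is void at `d_mod = 1`**: the antecedent `¬ slot-constant` of the registered stub `stub_hullRegime` fails at
every genuine datum of a `d_mod = 1` point, so the stub holds there with ANY conclusion `C`.
[cite: Mochizuki2012, IUTchIV Thm. 1.10 proof Step (v) p. 27–28] -/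
theorem hullRegime_vacuous_of_dmod_eq_one (hd : Cor22.dmod P = 1) (T : Cor22.ThetaVolumeDatumAt P l) {C : Prop}
    (hnc : letI := T.instFieldF; letI := T.instNumberFieldF; letI := T.instAlgebraF; letI := T.instFieldK
      letI := T.instNumberFieldK; letI := T.instAlgebraK; letI := T.instFieldFbar; letI := T.instAlgebraFbar
      letI := T.instAlgebraKFbar; letI := T.instIsElliptic
      ¬ (∀ p ∈ T.I.supportPrimes, ∀ v w : placesOver (fieldOfModuli T.E) p,
        (Summit.ABC.IUTFork.DHData.ofInput T.I).logQloc p v = (Summit.ABC.IUTFork.DHData.ofInput T.I).logQloc p w)) :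
    C :=
  absurd (PointStepV.slotConstant_of_dmod_eq_one T hd) hnc

/-- **The two registered crux-content stub signatures, cut to degree `≤ 1`, are equivalent** (binders EXACTLY those of
the registered stubs `stub_cor312` / `stub_cor312PerImage` of skeleton `3f4b202b4c999d58`, plus `P.degree ≤ 1`).
[cite: Mochizuki2012, IUTchIII Cor. 3.12 p. 174] [claim: Mochizuki2012, status: disputed] -/
theorem stub_cor312_iff_stub_cor312PerImage_on_degree_le_one :
    (∀ P : NFPoint, P ∈ UP → P.degree ≤ 1 → ∀ l : ℕ, l.Prime → 5 ≤ l →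
      Cor22.AdmitsCore P → Cor22.CondP2 P l → Cor22.CondP5 P l → Cor22.CondP6 P l → Cor22.Cor312AtDatum P l) ↔
    (∀ P : NFPoint, P ∈ UP → P.degree ≤ 1 → ∀ l : ℕ, l.Prime → 5 ≤ l →
      Cor22.AdmitsCore P → Cor22.CondP2 P l → Cor22.CondP5 P l → Cor22.CondP6 P l → Cor22.Cor312PerImageAtDatum P l) :=
  ⟨fun h P hP hdeg l hl h5 hc h2 hP5 h6 =>
      (cor312AtDatum_iff_perImage_of_degree_le_one hdeg).mp (h P hP hdeg l hl h5 hc h2 hP5 h6),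
    fun h P hP hdeg l hl h5 hc h2 hP5 h6 =>
      (cor312AtDatum_iff_perImage_of_degree_le_one hdeg).mpr (h P hP hdeg l hl h5 hc h2 hP5 h6)⟩

end Summit.ABC.ABC.Theorems.ThetaPartII

end
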